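import Literature.NumberTheory.Automorphic.Liu2021.SplitPlaceOscillatorModelExplicit
import Literature.NumberTheory.Automorphic.UnitaryGroupSplitPlaceHeckeEigenvalues
import Literature.NumberTheory.Automorphic.AdicCompletionLocalField
import HarnessLib

/-!
# [Liu2021, Lemma D.1 (2)] at a split place, `N = 2`: the LOCAL Hecke eigen-equations of the theta quotient, explicit, in `U(J)(F_v)`-currency

Topic `Literature/NumberTheory/Automorphic/Liu2021`; proof file (one theorem + one private helper: no definition, no named fact,
no instance); count-neutral.  Sequel to `SplitPlaceSatakeParametersExplicit` (the `∃`-form `IsSatakeParameter`) in the `∀`-form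
and in the currency consumed by the global assembly: the split-place model with explicit characters
(`splitPlace_chiCoinv_iso_parabolicIndGL_explicit`: the `χ`-coinvariants of `ω_s` under the centre, read on `GL_N(E_w)` along
`e_w = localPiSplitEquiv`, are `AreIsomorphicRep` to `Ind_{Q_{(N-1,1)}}((ν∘det) ⊠ χ′ν^{1-N})`) is composed, at `N = 2`, with
`UnitaryGroup.heckeOperator_localInt_apply_eq_smul_of_equiv_parabolicIndGL` (`UnitaryGroupSplitPlaceHeckeEigenvalues`: the
`U(J)(𝒪_v)`-level double coset operators of `e_w⁻¹(diag(ϖ_w,1))`, `e_w⁻¹(diag(ϖ_w,ϖ_w))` act on EVERY `U(J)(𝒪_v)`-fixed vector of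
a representation so modelled by `q_w^{1/2}(ν(ϖ_w) + χ′(ϖ_w)ν(ϖ_w)⁻¹)` and `χ′(ϖ_w)`):

* `splitPlace_chiCoinv_heckeOperator_localInt_apply_explicit` — for the `χ`-coinvariant representation of `U(J)(F_v)` itself (NOT
  composed with `e_w⁻¹`) and every `U(J)(𝒪_v)`-fixed coinvariant `y`: the two eigen-equations above.  This is EXACTLY the `hloc`
  input of `UnitaryGroup.IsHyperspecialAt.heckeTAt_apply_eq_smul` / `heckeTAt_apply_eq_smul_of_isRestrictedTensorProductRep`
  for the `v`-factor `ρv v := ` these coinvariants; no unramifiedness hypothesis is needed (for ramified data the fixed space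
  is `0`).

The inputs `(Γ, η, hΓi, hmodel)` and `hη` (with `νK := ((χ_v)_w ∘ ι_w)⁻¹`) are supplied for THE `χ`-attached splitting by the
cell's S4b-3 chain (`GelbartRogawski1991/LocalUnitaryUndoublingSplitMixedModel`); `hν`, `hχ′` pin `ν`, `χ′`.

## References

* Y. Liu, *Fourier–Jacobi cycles and arithmetic relative trace formula*, Cambridge J. Math. 9 (2021), App. D,
  Lemma D.1 (2) and its proof, p. 126. [Liu2021]
* C. Mœglin, M.-F. Vignéras, J.-L. Waldspurger, LNM 1291 (1987), Chap. 3, III.7. [MoeglinVignerasWaldspurger1987]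
* P. Cartier, *Representations of 𝔭-adic groups: a survey*, PSPM 33 (1979), part 1, §IV (4.2). [CartierCorvallis1979]
* J. R. Getz, H. Hahn, *An Introduction to Automorphic Representations*, GTM 300 (2024), Prop. 2.3.1. [GetzHahn2024]
-/

set_option autoImplicit false

noncomputable section

open NumberField IsDedekindDomain Matrix
open _root_.MeasureTheory
open scoped MatrixGroups
open ValuativeRel
open Literature.RepresentationTheory (TwistedCoinv.rep TwistedCoinv.Coinv TwistedCoinv.mk)
open Literature.RepresentationTheory.HeisenbergGroup (MpPsi leviOpPi)
open Literature.RepresentationTheory.HeisenbergGroup.SymplecticMatrix (glEquiv)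
open Literature.NumberTheory.GelbartRogawski1991.UnitaryDualPair.LocalSplitting (iota LocalMp localSchrodinger)
open Literature.NumberTheory.Automorphic.Zelevinsky1980 (lastBlockLabel maxParabolicLeviChar)
open Literature.NumberTheory.Automorphic.UnitaryGroup

namespace Literature.NumberTheory.Automorphic.Liu2021

/-- An `AreIsomorphicRep` witness is a `Representation.Equiv`. [folklore] -/
private theorem nonempty_equiv_of_areIsomorphicRep' {G : Type*} [Group G] {V₁ V₂ : Type*} [AddCommGroup V₁] [Module ℂ V₁]
    [AddCommGroup V₂] [Module ℂ V₂] {ρ₁ : Representation ℂ G V₁} {ρ₂ : Representation ℂ G V₂}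
    (h : AreIsomorphicRep ρ₁ ρ₂) : Nonempty (ρ₁.Equiv ρ₂) := by
  obtain ⟨f, hf⟩ := h
  exact ⟨Representation.Equiv.mk f fun g => LinearMap.ext fun x => hf g x⟩

set_option maxHeartbeats 2000000 in -- as in `SplitPlaceOscillatorModelExplicit` / `SplitPlaceSatakeParametersExplicit`: instantiating the ≈ 40 heavy binders of the explicit model at `N := 2` costs ≈ 1M heartbeats of `isDefEq`; the proof itself is 3 lines
/-- **[Liu2021, Lem. D.1 (2)] at a split place, `N = 2`, explicit, `∀`-form in `U(J)(F_v)`-currency: the LOCAL Hecke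
eigen-equations of the theta quotient.**  Data and hypotheses: those of `splitPlace_chiCoinv_iso_parabolicIndGL_explicit` at
`N := 2` (split place `v`, `w ∣ v` with `c • w ≠ w`, smooth unitary section `s`, hermitian line `J₁`, unitary continuous central
character `χ`, a mixed-model pair `(Γ, η)` of `ω_s` with `η(κ_a) = νK(det a)`, `ν ∘ ι_w = νK`, `χ′(z_w) = χ(z)`), PLUS `J` of good
reduction at `w` (`hJi`) and a uniformizer `ϖ_w` of `E_w`.  Conclusion: on EVERY `U(J)(𝒪_v)`-fixed vector `y` of the
`χ`-coinvariant representation of `U(J)(F_v)`, the double coset operators of `e_w⁻¹(diag(ϖ_w, 1))` and `e_w⁻¹(diag(ϖ_w, ϖ_w))` act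
by `q_w^{1/2}(ν(ϖ_w) + χ′(ϖ_w)ν(ϖ_w)⁻¹)` and by `χ′(ϖ_w)`.  Proof: the `AreIsomorphicRep` witness is a `Representation.Equiv`;
apply `UnitaryGroup.heckeOperator_localInt_apply_eq_smul_of_equiv_parabolicIndGL`.
[cite: Liu2021, App. D, Lemma D.1 (2) and proof of Lemma D.1 (first paragraph), p. 126]
[cite: CartierCorvallis1979, §IV (4.2)] -/
theorem splitPlace_chiCoinv_heckeOperator_localInt_apply_explicit
    (F : Type) [Field F] [NumberField F] (E : Type) [Field E] [NumberField E] [Algebra F E]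
    [Algebra.IsQuadraticExtension F E] (c : E ≃ₐ[F] E) (hc1 : c ≠ 1) (δ : E) (hcδ : c δ = -δ)
    (hδ : δ ≠ 0) (d : F) (hd : δ * δ = algebraMap F E d) (T : Matrix (Fin 2) (Fin 2) F) (hT : T.IsSymm) (hTd : IsUnit T.det)
    (J : Matrix (Fin 2) (Fin 2) E) (hJ : J = T.map (algebraMap F E)) (hJh : (J.map c)ᵀ = J)
    (v : HeightOneSpectrum (𝓞 F)) (w : UnitaryGroup.PlacesOver E v) (hw : c • (w : HeightOneSpectrum (𝓞 E)) ≠ w)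
    (hJw : IsUnit (UnitaryGroup.placeForm J (w : HeightOneSpectrum (𝓞 E))))
    [MeasurableSpace (v.adicCompletion F)] [BorelSpace (v.adicCompletion F)]
    (μX : Measure (Fin 2 → v.adicCompletion F)) [μX.IsAddHaarMeasure]
    (s : UnitaryGroup.localPi E c 2 J v →* LocalMp F 2 T v)
    (hs : ∀ g, MpPsi.proj _ (s g) = iota F E c 2 hcδ hδ hd T hT hJ v g)
    (hsm : Representation.IsSmooth ((MpPsi.toRep (localSchrodinger F 2 T v)).comp s))
    (hsu : Representation.IsL2Isometric μX ((MpPsi.toRep (localSchrodinger F 2 T v)).comp s))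
    (J₁ : Matrix (Fin 1) (Fin 1) E) (hJ₁ : J₁ 0 0 ≠ 0)
    [LocallyCompactSpace (standardParabolicGL ((w : HeightOneSpectrum (𝓞 E)).adicCompletion E)
      (Zelevinsky1980.lastBlockLabel 2))]
    (μ' : Measure (v.adicCompletion F)) [μ'.IsAddHaarMeasure]
    (Γ : (SchwartzBruhat (Fin 2 → v.adicCompletion F)) ≃ₗ[ℂ] (SchwartzBruhat (Fin 2 → v.adicCompletion F)))
    (η : UnitaryGroup.localPi E c 2 J v →* ℂˣ)
    (hΓi : ∀ Φ : (SchwartzBruhat (Fin 2 → v.adicCompletion F)), SchwartzBruhat.l2NormSq (Measure.pi fun _ : Fin 2 => μ') (Γ Φ) =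
      SchwartzBruhat.l2NormSq (Measure.pi fun _ : Fin 2 => μ') Φ)
    (hmodel : ∀ (a : GL (Fin 2) (v.adicCompletion F)) (Φ : (SchwartzBruhat (Fin 2 → v.adicCompletion F))),
      (MpPsi.toRep (localSchrodinger F 2 T v)).comp s
          ((UnitaryGroup.localPiSplitEquiv c J hc1 hJh w hw hJw).symm (Matrix.GeneralLinearGroup.map (toPlace v w) a)) Φ =
        ((η ((UnitaryGroup.localPiSplitEquiv c J hc1 hJh w hw hJw).symm (Matrix.GeneralLinearGroup.map (toPlace v w) a)) : ℂˣ) :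
            ℂ) • Γ.symm (leviOpPi (glEquiv (GLn.contragredient a)) (Γ Φ)))
    (νK : (v.adicCompletion F)ˣ →* ℂˣ)
    (hη : ∀ a : GL (Fin 2) (v.adicCompletion F),
      η ((UnitaryGroup.localPiSplitEquiv c J hc1 hJh w hw hJw).symm (Matrix.GeneralLinearGroup.map (toPlace v w) a)) =
        νK (Matrix.GeneralLinearGroup.det a))
    (ν : ((w : HeightOneSpectrum (𝓞 E)).adicCompletion E)ˣ →* ℂˣ)
    (hν : ∀ t : (v.adicCompletion F)ˣ,
      ν (Units.map (toPlace v w : v.adicCompletion F →+* (w : HeightOneSpectrum (𝓞 E)).adicCompletion E).toMonoidHom t) = νK t)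
    (χ : UnitaryGroup.localPi E c 1 J₁ v →* ℂˣ) (hχu : ∀ z, ‖((χ z : ℂˣ) : ℂ)‖ = 1)
    (hχc : Continuous fun z => ((χ z : ℂˣ) : ℂ))
    (χ' : ((w : HeightOneSpectrum (𝓞 E)).adicCompletion E)ˣ →* ℂˣ)
    (hχ' : ∀ z : UnitaryGroup.localPi E c 1 J₁ v,
      χ' (Matrix.GeneralLinearGroup.det ((z : UnitaryGroup.LocalGLPi E 1 v) w)) = χ z)
    -- NEW w.r.t. the explicit model: good reduction of `J` at `w` and a uniformizer of `E_w`
    (hJi : hJw.unit ∈ glInt 2 ((w : HeightOneSpectrum (𝓞 E)).adicCompletion E))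
    {ϖ : (w : HeightOneSpectrum (𝓞 E)).adicCompletion E} (hϖ : IsUniformizingElement ϖ)
    {y : TwistedCoinv.Coinv
      (show Representation ℂ (UnitaryGroup.localPi E c 1 J₁ v) (SchwartzBruhat (Fin 2 → v.adicCompletion F)) from
        ((MpPsi.toRep (localSchrodinger F 2 T v)).comp s).comp (UnitaryGroup.localCenter E c 2 J J₁ hJ₁ v)) χ}
    (hy : y ∈ (TwistedCoinv.rep
        (ρW := show Representation ℂ (UnitaryGroup.localPi E c 1 J₁ v) (SchwartzBruhat (Fin 2 → v.adicCompletion F)) from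
          ((MpPsi.toRep (localSchrodinger F 2 T v)).comp s).comp (UnitaryGroup.localCenter E c 2 J J₁ hJ₁ v))
        χ ((MpPsi.toRep (localSchrodinger F 2 T v)).comp s)
        (fun g z => (show Commute g (UnitaryGroup.localCenter E c 2 J J₁ hJ₁ v z) from
          UnitaryGroup.localCenter_comm E c 2 J J₁ hJ₁ v z g).map ((MpPsi.toRep (localSchrodinger F 2 T v)).comp s))).fixedPoints
        (UnitaryGroup.localInt E c 2 J v)) :
    heckeOperator
        (TwistedCoinv.rep
          (ρW := show Representation ℂ (UnitaryGroup.localPi E c 1 J₁ v) (SchwartzBruhat (Fin 2 → v.adicCompletion F)) from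
            ((MpPsi.toRep (localSchrodinger F 2 T v)).comp s).comp (UnitaryGroup.localCenter E c 2 J J₁ hJ₁ v))
          χ ((MpPsi.toRep (localSchrodinger F 2 T v)).comp s)
          (fun g z => (show Commute g (UnitaryGroup.localCenter E c 2 J J₁ hJ₁ v z) from
            UnitaryGroup.localCenter_comm E c 2 J J₁ hJ₁ v z g).map ((MpPsi.toRep (localSchrodinger F 2 T v)).comp s)))
        (UnitaryGroup.localInt E c 2 J v)
        ((UnitaryGroup.localPiSplitEquiv c J hc1 hJh w hw hJw).symm (heckeDiag 2 (Units.mk0 ϖ hϖ.ne_zero) 1)) y =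
        ((Real.sqrt (GaloisRepresentations.IsNonarchimedeanLocalField.residueFieldCard
            ((w : HeightOneSpectrum (𝓞 E)).adicCompletion E)) : ℂ) *
          (((ν (Units.mk0 ϖ hϖ.ne_zero) : ℂˣ) : ℂ) +
            ((χ' (Units.mk0 ϖ hϖ.ne_zero) : ℂˣ) : ℂ) * (((ν (Units.mk0 ϖ hϖ.ne_zero) : ℂˣ) : ℂ))⁻¹)) • y ∧
      heckeOperator
        (TwistedCoinv.rep
          (ρW := show Representation ℂ (UnitaryGroup.localPi E c 1 J₁ v) (SchwartzBruhat (Fin 2 → v.adicCompletion F)) from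
            ((MpPsi.toRep (localSchrodinger F 2 T v)).comp s).comp (UnitaryGroup.localCenter E c 2 J J₁ hJ₁ v))
          χ ((MpPsi.toRep (localSchrodinger F 2 T v)).comp s)
          (fun g z => (show Commute g (UnitaryGroup.localCenter E c 2 J J₁ hJ₁ v z) from
            UnitaryGroup.localCenter_comm E c 2 J J₁ hJ₁ v z g).map ((MpPsi.toRep (localSchrodinger F 2 T v)).comp s)))
        (UnitaryGroup.localInt E c 2 J v)
        ((UnitaryGroup.localPiSplitEquiv c J hc1 hJh w hw hJw).symm (heckeDiag 2 (Units.mk0 ϖ hϖ.ne_zero) 2)) y =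
        ((χ' (Units.mk0 ϖ hϖ.ne_zero) : ℂˣ) : ℂ) • y := by
  obtain ⟨-, hiso⟩ := splitPlace_chiCoinv_iso_parabolicIndGL_explicit F E c hc1 2 le_rfl δ hcδ hδ d hd T hT hTd J hJ hJh v w
    hw hJw μX s hs hsm hsu J₁ hJ₁ μ' Γ η hΓi hmodel νK hη ν hν χ hχu hχc χ' hχ'
  obtain ⟨e⟩ := nonempty_equiv_of_areIsomorphicRep' hiso
  exact UnitaryGroup.heckeOperator_localInt_apply_eq_smul_of_equiv_parabolicIndGL c J hc1 hJh w hw hJw hJi _ ν χ' e hϖ hy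

end Literature.NumberTheory.Automorphic.Liu2021

end
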